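import Summits.Langlands.Langlands.Theses.HeckeFieldDeRham

/-!
# SkelVet model — stmt-Langlands-17408 `AlgebraicTraceRigidity` (route-Langlands-HeckeFieldDeRham)

NOT the planner's skeleton (its text, gate evidence `20260817T015949Z-AlgebraicTraceRigidity_birth.lean`,
is not readable on this hub and was never published as `Lines/birth.lean` nor registered).
This file models the DESCRIBED split
`stub_atr_companions → stub_atr_systemDeRham → AlgebraicTraceRigidity_of`
with two candidate shapes of the skeleton's locally vendored family predicate `InCompatibleFamily`
and shows that either shape fails BC3:

* Horn A (`InFamilyA`, de Rham INSIDE the family predicate — the shape of the tree's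
  `Literature.NumberTheory.Automorphic.IsWeaklyCompatibleFamily`, clause at `v ∣ ℓ`):
  stub 2 is a projection (`stubSystemDeRhamA_trivial`) and stub 1 ALONE implies the crux
  (`atr_of_stubCompanionsA`) — the BC3 probe `stub → C` succeeds by a three-line term.
* Horn B (`InFamilyB`, a partial / linkless family: members only asked to satisfy the ATR hypotheses at
  their own prime, family defined on a set of primes containing `ℓ`): the singleton `{ρ}` inhabits it
  (`stubCompanionsB_trivial`), so stub 2 is EQUIVALENT to the crux
  (`atr_of_stubSystemDeRhamB`, `stubSystemDeRhamB_of_atr`).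

A genuine split needs a family predicate strictly between the horns: E-rational Frobenius polynomials with
ONE `E` and pairwise charpoly compatibility across primes, a.e. unramified, members at EVERY prime, and NO
de Rham / crystalline clause at the member's own prime.  The re-vet must test the real `InCompatibleFamily`
against both horns by hand-instantiation, not only by `exact? | simpa | aesop`.
-/

set_option linter.dupNamespace false

namespace Summit.Langlands.Langlands.Cruxes.AlgebraicTraceRigidity.SkelVet

open Literature.NumberTheory.GaloisRepresentations Literature.NumberTheory.PAdicHodge
open Summit.Langlands.Langlands.Theses.HeckeFieldDeRham (AlgebraicTraceRigidity)

section Defs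

variable (F : Type) [Field F] [NumberField F] (n : ℕ)

/-- The three hypotheses of ATR on one `ℓ`-adic `ρ` (irreducible, a.e. unramified, `E`-rational a.e.). -/
def Hyp (ℓ : ℕ) [Fact ℓ.Prime] (ρ : FramedGaloisRep F (PadicAlgCl ℓ) n) : Prop :=
  ρ.toGaloisRep.IsIrreducible ∧
  (∀ᶠ v : IsDedekindDomain.HeightOneSpectrum (NumberField.RingOfIntegers F) in Filter.cofinite,
      ρ.IsUnramifiedAt v) ∧
  (∃ E : Subfield (PadicAlgCl ℓ), FiniteDimensional ℚ E ∧
    ∀ᶠ v : IsDedekindDomain.HeightOneSpectrum (NumberField.RingOfIntegers F) in Filter.cofinite,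
      ∃ P : Polynomial (PadicAlgCl ℓ), (∀ i : ℕ, P.coeff i ∈ E) ∧ ρ.HasFrobCharpolyAt v P)

/-- The conclusion of ATR on one `ℓ`-adic `ρ`: de Rham for the pinned datum at every `v ∣ ℓ`. -/
def Concl (ℓ : ℕ) [Fact ℓ.Prime] (ρ : FramedGaloisRep F (PadicAlgCl ℓ) n) : Prop :=
  ∀ (v : IsDedekindDomain.HeightOneSpectrum (NumberField.RingOfIntegers F))
    (hv : ((ℓ : ℕ) : NumberField.RingOfIntegers F) ∈ v.asIdeal),
    (fontainePstAdicCompletion v ℓ hv).IsDeRhamFramed (ρ.toLocal v)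

/-- Horn A: `ρ` is the `ℓ`-member of a prime-indexed family all of whose members satisfy `Hyp` AND
`Concl` (de Rham built into the family predicate, as in the tree's `IsWeaklyCompatibleFamily`). -/
def InFamilyA (ℓ : ℕ) [Fact ℓ.Prime] (ρ : FramedGaloisRep F (PadicAlgCl ℓ) n) : Prop :=
  ∃ r : ∀ (ℓ' : ℕ) [Fact ℓ'.Prime], FramedGaloisRep F (PadicAlgCl ℓ') n,
    r ℓ = ρ ∧ ∀ (ℓ' : ℕ) [Fact ℓ'.Prime], Hyp F n ℓ' (r ℓ') ∧ Concl F n ℓ' (r ℓ')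

/-- Horn B: a PARTIAL, linkless family — defined on some set of primes containing `ℓ`, each member only
asked to satisfy `Hyp` at its own prime. -/
def InFamilyB (ℓ : ℕ) [Fact ℓ.Prime] (ρ : FramedGaloisRep F (PadicAlgCl ℓ) n) : Prop :=
  ∃ r : ∀ (ℓ' : ℕ) [Fact ℓ'.Prime], Option (FramedGaloisRep F (PadicAlgCl ℓ') n),
    r ℓ = some ρ ∧ ∀ (ℓ' : ℕ) [Fact ℓ'.Prime] (σ : FramedGaloisRep F (PadicAlgCl ℓ') n),
      r ℓ' = some σ → Hyp F n ℓ' σ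

end Defs

/-- ATR unfolded as `Hyp → Concl`. -/
theorem atr_iff : AlgebraicTraceRigidity ↔
    ∀ (F : Type) [Field F] [NumberField F] (n ℓ : ℕ) [Fact ℓ.Prime]
      (ρ : FramedGaloisRep F (PadicAlgCl ℓ) n), Hyp F n ℓ ρ → Concl F n ℓ ρ := by
  constructor
  · intro h F _ _ n ℓ _ ρ hyp
    exact h F n ℓ ρ hyp.1 hyp.2.1 hyp.2.2
  · intro h F _ _ n ℓ _ ρ h1 h2 h3
    exact h F n ℓ ρ ⟨h1, h2, h3⟩

/-! ## Horn A -/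

/-- Model of `stub_atr_companions` over Horn A. -/
def StubCompanionsA : Prop :=
  ∀ (F : Type) [Field F] [NumberField F] (n ℓ : ℕ) [Fact ℓ.Prime]
    (ρ : FramedGaloisRep F (PadicAlgCl ℓ) n), Hyp F n ℓ ρ → InFamilyA F n ℓ ρ

/-- Model of `stub_atr_systemDeRham` over Horn A. -/
def StubSystemDeRhamA : Prop :=
  ∀ (F : Type) [Field F] [NumberField F] (n ℓ : ℕ) [Fact ℓ.Prime]
    (ρ : FramedGaloisRep F (PadicAlgCl ℓ) n),
    ρ.toGaloisRep.IsIrreducible → InFamilyA F n ℓ ρ → Concl F n ℓ ρ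

/-- Horn A: stub 2 is TRIVIAL (a projection of the family predicate). -/
theorem stubSystemDeRhamA_trivial : StubSystemDeRhamA := by
  intro F _ _ n ℓ _ ρ _ hfam
  obtain ⟨r, hr, h⟩ := hfam
  subst hr
  exact (h ℓ).2

/-- Horn A: stub 1 ALONE implies the crux (`stub → C` probe succeeds: line.shredded). -/
theorem atr_of_stubCompanionsA (h : StubCompanionsA) : AlgebraicTraceRigidity := by
  rw [atr_iff]
  intro F _ _ n ℓ _ ρ hyp
  obtain ⟨r, hr, hfam⟩ := h F n ℓ ρ hyp
  subst hr
  exact (hfam ℓ).2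

/-! ## Horn B -/

/-- Model of `stub_atr_companions` over Horn B. -/
def StubCompanionsB : Prop :=
  ∀ (F : Type) [Field F] [NumberField F] (n ℓ : ℕ) [Fact ℓ.Prime]
    (ρ : FramedGaloisRep F (PadicAlgCl ℓ) n), Hyp F n ℓ ρ → InFamilyB F n ℓ ρ

/-- Model of `stub_atr_systemDeRham` over Horn B. -/
def StubSystemDeRhamB : Prop :=
  ∀ (F : Type) [Field F] [NumberField F] (n ℓ : ℕ) [Fact ℓ.Prime]
    (ρ : FramedGaloisRep F (PadicAlgCl ℓ) n),
    ρ.toGaloisRep.IsIrreducible → InFamilyB F n ℓ ρ → Concl F n ℓ ρ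

/-- Horn B: stub 1 is TRIVIAL — the singleton family `{ρ}`. -/
theorem stubCompanionsB_trivial : StubCompanionsB := by
  intro F _ _ n ℓ _ ρ hyp
  classical
  refine ⟨fun ℓ' _ => if h : ℓ' = ℓ then some (by subst h; exact ρ) else none, ?_, ?_⟩
  · simp
  · intro ℓ' _ σ hσ
    by_cases h : ℓ' = ℓ
    · subst h
      simp only [dite_true, Option.some.injEq] at hσ
      subst hσ
      exact hyp
    · simp [h] at hσ

/-- Horn B: stub 2 implies the crux … -/
theorem atr_of_stubSystemDeRhamB (h : StubSystemDeRhamB) : AlgebraicTraceRigidity := by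
  rw [atr_iff]
  intro F _ _ n ℓ _ ρ hyp
  exact h F n ℓ ρ hyp.1 (stubCompanionsB_trivial F n ℓ ρ hyp)

/-- … and conversely: over Horn B, stub 2 IS the crux (costume). -/
theorem stubSystemDeRhamB_of_atr (h : AlgebraicTraceRigidity) : StubSystemDeRhamB := by
  rw [atr_iff] at h
  intro F _ _ n ℓ _ ρ _ hfam
  obtain ⟨r, hr, hfam⟩ := hfam
  exact h F n ℓ ρ (hfam ℓ ρ hr)

theorem stubSystemDeRhamB_iff_atr : StubSystemDeRhamB ↔ AlgebraicTraceRigidity :=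
  ⟨atr_of_stubSystemDeRhamB, stubSystemDeRhamB_of_atr⟩

end Summit.Langlands.Langlands.Cruxes.AlgebraicTraceRigidity.SkelVet
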